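import Summits.Ventures.HSemireg.Pad4TowerFCCoreSeam
import Summits.Ventures.HSemireg.Pad4TowerDiamondMu4
import Summits.Ventures.HSemireg.Pad4TowerLineMoments

/-!
# PAD-4 on 𝔅(μ₄): the HALF-SUM LATTICE LAW — `16 ∣ N(uuuu)` and `μ ∈ 32ℤ[i]` for EVERY integer (A1)-clean design with
# parity-axial letters (HSemireg support file; phase-torus line, «control» lens g6 CYCLE LINE «BOX LAW ∕ μ-LATTICE», alphabet-free form, module 1 of 2)

Crux of record: `Summit.HodgeConjecture.HodgeConjecture.Theses.EightfoldBlochSeeds.BlochSeedDiscOne`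
(= `HasHyperbolicBlochSeed 4 1`, item stmt-HodgeConjecture-18881; skeleton `Lines/birth.lean`, STUB R `stub_rung_pad4_seedAt`).
Nothing in this file proves HC, HC_AV, HC_CM, H2 or item 18881; census-neutral (no SAT∕UNSAT row is added or changed).

WHAT THIS FILE IS (tree copy of §1–§5 of the crux workfile `Cruxes/BlochSeedDiscOne/HalfSumLattice.lean` v3 23bb976bcaee1627, author
plan-lens-HodgeAV-control g6, statements verbatim; pen proof, exact machine lattice and data 471∕471: memo `Cruxes/BlochSeedDiscOne/BOX-LAW-g6.md`
§10; director-hodge word «K-HALFSUM»; critic idea-crit-6 g12 KERNEL PLATE on v2∕v3).  THE MECHANISM (no torus, no flow, no line, no height):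
for a letter `x = (α, β)`, `β = x₁ + i x₂`, put `G(x) = 2α + (1 − i)β + (1 + i)β̄ = 2(α + x₁ + x₂)` and `G'(x) = 2(α + x₁ − x₂)` —
honest LETTER FUNCTIONALS (`lfun`; a cell's class tensor is the product of its letters, `Pad4TowerLineMoments`' `LinePhaseTorus.ch_eq_prod`) — and for a PARITY-AXIAL letter (`β` on an axis, `α ≡ |β| (mod 2)`: `ParityAxial`; every letter of
every `◇_h`, sequel) `4 ∣ G(x)`, `4 ∣ G'(x)`, `4 ∣ p(x) = α² − |β|²`.  Expanding a product of letter functionals over the class words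
(`HS_expand`) and applying the screen (A1) (`HS_expand_screen`):
* `Σ ν ∏_f G(x_f)            = 16·N(uuuu) − 4μ − 4μ̄`   (`halfSum_GGGG`),
* `Σ ν G(x₀)G(x₁)G(x₂)G'(x₃)  = 16·N(uuuu) − 4iμ + 4iμ̄`  (`halfSum_GGGG'`),
* `Σ ν G(x₀)G(x₁)·p(x₂)·1     = 4·N(uup1) = 4·N(uuuu)`   (`halfSum_GGp1`, (A1)(ii): `uup1`, `uuuu` are e-free of degree 4),
so `16 ∣ N(uuuu)`, `32 ∣ re μ`, `32 ∣ im μ`: **`parityAxialDesign_mu_dvd`** — ANY support, rank, multiplicities, signs; no presentation.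
Everything here is PROVED (axioms `propext`, `Classical.choice`, `Quot.sound`; no `sorry`, no named fact, no instance, no notation).

NOT a statement about sheaves, monads, a SOURCE or a SEED.  Sequel (`|μ|² ≥ 1024`, `◇_h`, mass law, e-free ladder): `Pad4TowerHalfSumLatticeMass`;
sharpness (`μ = 32i` attained): `Pad4TowerSharpWitness32`.  Tree filing: hsemireg-phasetorus-typer-1 g2.
-/

namespace Summit.Ventures.HSemireg.HalfSum

open Finset BigOperators Summit.Ventures.HSemireg Summit.Ventures.HSemireg.Pad4Tower

/-! ## §1 letter functionals and their expansion over class words -/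

/-- a LETTER FUNCTIONAL `Σ_j c_j · (letter j of x)` on the six class letters `1, u, v, e, ē, p`. -/
def lfun (c : Fin 6 → GaussianInt) (x : BPoint) : GaussianInt := ∑ j, c j * bphi x j

/-- per cell: a product of four letter functionals expands over the class words. -/
theorem prod_lfun (c : Fin 4 → Fin 6 → GaussianInt) (Z : MCell) :
    ∏ f, lfun (c f) (Z f) = ∑ w : CWord, (∏ f, c f (w f)) * Z.ch w := by
  simp only [lfun]
  rw [Finset.prod_univ_sum]
  simp only [Fintype.piFinset_univ]
  refine Finset.sum_congr rfl fun w _ => ?_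
  rw [LinePhaseTorus.ch_eq_prod, ← Finset.prod_mul_distrib]

/-- the design-level pairing with a product of letter functionals. -/
def HS (C : MConfig) (mN mP : MCell → ℤ) (c : Fin 4 → Fin 6 → GaussianInt) : GaussianInt :=
  ∑ Z ∈ C.lower, (mN Z : GaussianInt) * ∏ f, lfun (c f) (Z f) -
    ∑ P ∈ C.upper, (mP P : GaussianInt) * ∏ f, lfun (c f) (P f)

/-- the class function evaluated at a word. -/
theorem wch_apply (C : MConfig) (mN mP : MCell → ℤ) (w : CWord) :
    C.wch mN mP w = ∑ Z ∈ C.lower, (mN Z : GaussianInt) * Z.ch w - ∑ P ∈ C.upper, (mP P : GaussianInt) * P.ch w := by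
  simp only [MConfig.wch, Pi.sub_apply, Finset.sum_apply, Pi.smul_apply]
  simp only [zsmul_eq_mul]

/-- **expansion**: `HS(c) = Σ_w (∏_f c_f(w_f)) · N(w)`. -/
theorem HS_expand (C : MConfig) (mN mP : MCell → ℤ) (c : Fin 4 → Fin 6 → GaussianInt) :
    HS C mN mP c = ∑ w : CWord, (∏ f, c f (w f)) * C.wch mN mP w := by
  simp only [HS, prod_lfun, wch_apply, Finset.mul_sum, mul_sub, Finset.sum_sub_distrib]
  congr 1
  · rw [Finset.sum_comm]
    refine Finset.sum_congr rfl fun w _ => Finset.sum_congr rfl fun Z _ => by ring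
  · rw [Finset.sum_comm]
    refine Finset.sum_congr rfl fun w _ => Finset.sum_congr rfl fun Z _ => by ring

/-- under the screen (A1)(i), only e-free words and `eeee`, `ēēēē` contribute. -/
theorem HS_expand_screen (C : MConfig) (mN mP : MCell → ℤ) (c : Fin 4 → Fin 6 → GaussianInt)
    (hA1 : ClassScreen (C.wch mN mP)) :
    HS C mN mP c = ∑ w ∈ (Finset.univ.filter fun w : CWord => EFree w ∨ w = eWord ∨ w = ebarWord),
      (∏ f, c f (w f)) * C.wch mN mP w := by
  rw [HS_expand, ← Finset.sum_filter_add_sum_filter_not Finset.univ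
    (fun w : CWord => EFree w ∨ w = eWord ∨ w = ebarWord)]
  rw [add_eq_left]
  refine Finset.sum_eq_zero fun w hw => ?_
  rw [Finset.mem_filter] at hw
  push Not at hw
  rw [hA1.1 w hw.2.1 hw.2.2.1 hw.2.2.2, mul_zero]

/-! ## §2 the three functionals `G`, `G'`, `p`, `1` as coefficient vectors -/

/-- `G = 2u + (1 − i)e + (1 + i)ē`. -/
def cG : Fin 6 → GaussianInt := ![0, 2, 0, ⟨1, -1⟩, ⟨1, 1⟩, 0]
/-- `G' = 2u + (1 + i)e + (1 − i)ē`. -/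
def cG' : Fin 6 → GaussianInt := ![0, 2, 0, ⟨1, 1⟩, ⟨1, -1⟩, 0]
/-- the letter `p`. -/
def cP : Fin 6 → GaussianInt := ![0, 0, 0, 0, 0, 1]
/-- the letter `1`. -/
def c1 : Fin 6 → GaussianInt := ![1, 0, 0, 0, 0, 0]

/-- `G(x) = 2(α + x₁ + x₂)`. -/
theorem lfun_cG (x : BPoint) : lfun cG x = ((2 * (x.1 + x.2.1 + x.2.2) : ℤ) : GaussianInt) := by
  rw [lfun, Fin.sum_univ_six, Zsqrtd.ext_iff]
  simp [cG, bphi, phiVec]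
  constructor <;> ring

/-- `G'(x) = 2(α + x₁ − x₂)`. -/
theorem lfun_cG' (x : BPoint) : lfun cG' x = ((2 * (x.1 + x.2.1 - x.2.2) : ℤ) : GaussianInt) := by
  rw [lfun, Fin.sum_univ_six, Zsqrtd.ext_iff]
  simp [cG', bphi, phiVec]
  constructor <;> ring

/-- `p(x) = α² − |β|²`. -/
theorem lfun_cP (x : BPoint) : lfun cP x = ((x.1 ^ 2 - x.2.1 ^ 2 - x.2.2 ^ 2 : ℤ) : GaussianInt) := by
  rw [lfun, Fin.sum_univ_six]
  simp [cP, bphi, phiVec]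

/-- `1(x) = 1`. -/
theorem lfun_c1 (x : BPoint) : lfun c1 x = 1 := by
  rw [lfun, Fin.sum_univ_six]
  simp [c1, bphi, phiVec]

/-- the word `uuuu`. -/
def uWord : CWord := ![1, 1, 1, 1]
/-- the word `uup1`. -/
def uupWord : CWord := ![1, 1, 5, 0]

/-- `uuuu` is e-free of degree `4`. -/
theorem uWord_eFree : EFree uWord ∧ wdeg uWord = 4 := by decide
/-- `uup1` is e-free of degree `4`. -/
theorem uupWord_eFree : EFree uupWord ∧ wdeg uupWord = 4 := by decide

/-- (A1)(ii): `N(uup1) = N(uuuu)`. -/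
theorem wch_uup_eq (C : MConfig) (mN mP : MCell → ℤ) (hA1 : ClassScreen (C.wch mN mP)) :
    C.wch mN mP uupWord = C.wch mN mP uWord :=
  hA1.2 _ _ uupWord_eFree.1 uWord_eFree.1 (by rw [uupWord_eFree.2, uWord_eFree.2])

/-! ## §3 evaluating the three expansions -/

/-- the coefficient `∏_f c_f(w_f)` of the `GGGG`-type functionals vanishes off words in the letters `u, e, ē`. -/
theorem prod_coef_eq_zero {c : Fin 4 → Fin 6 → GaussianInt} {w : CWord}
    (h : ∃ f, c f (w f) = 0) : (∏ f, c f (w f)) = 0 := by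
  obtain ⟨f, hf⟩ := h
  exact Finset.prod_eq_zero (Finset.mem_univ f) hf

/-- the surviving words of `GGGG` / `GGGG'`: among e-free ∪ {eeee, ēēēē}, a word with all letters in `{u, e, ē}` is
`uuuu`, `eeee` or `ēēēē`. -/
theorem words_ueE (w : CWord) (hw : ∀ f, w f = 1 ∨ w f = 3 ∨ w f = 4)
    (hs : EFree w ∨ w = eWord ∨ w = ebarWord) : w = uWord ∨ w = eWord ∨ w = ebarWord := by
  rcases hs with he | he | he
  · left
    funext f
    have h1 := hw f; have h2 := he f
    rcases h1 with h | h | h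
    · rw [h]; fin_cases f <;> rfl
    · exact absurd h h2.1
    · exact absurd h h2.2
  · exact Or.inr (Or.inl he)
  · exact Or.inr (Or.inr he)

/-- `cG` is supported on the letters `u, e, ē`. -/
theorem cG_support (j : Fin 6) (hj : cG j ≠ 0) : j = 1 ∨ j = 3 ∨ j = 4 := by
  fin_cases j <;> simp_all [cG]
/-- `cG'` is supported on the letters `u, e, ē`. -/
theorem cG'_support (j : Fin 6) (hj : cG' j ≠ 0) : j = 1 ∨ j = 3 ∨ j = 4 := by
  fin_cases j <;> simp_all [cG']

/-- general evaluation: if every `c_f` is supported on `{u, e, ē}` then under (A1)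
`HS(c) = (∏ c_f(u)) N(uuuu) + (∏ c_f(e)) μ + (∏ c_f(ē)) μ̄`. -/
theorem HS_ueE (C : MConfig) (mN mP : MCell → ℤ) (c : Fin 4 → Fin 6 → GaussianInt)
    (hc : ∀ f j, c f j ≠ 0 → j = 1 ∨ j = 3 ∨ j = 4) (hA1 : ClassScreen (C.wch mN mP)) :
    HS C mN mP c = (∏ f, c f 1) * C.wch mN mP uWord + (∏ f, c f 3) * C.wch mN mP eWord
      + (∏ f, c f 4) * C.wch mN mP ebarWord := by
  rw [HS_expand_screen C mN mP c hA1]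
  have hsub : ∀ w ∈ Finset.univ.filter (fun w : CWord => EFree w ∨ w = eWord ∨ w = ebarWord),
      w ∉ ({uWord, eWord, ebarWord} : Finset CWord) → (∏ f, c f (w f)) * C.wch mN mP w = 0 := by
    intro w hw hn
    rw [Finset.mem_filter] at hw
    have : ∃ f, c f (w f) = 0 := by
      by_contra hne
      push Not at hne
      have hw' : ∀ f, w f = 1 ∨ w f = 3 ∨ w f = 4 := fun f => hc f (w f) (hne f)
      rcases words_ueE w hw' hw.2 with h | h | h <;> simp [h] at hn
    rw [prod_coef_eq_zero this, zero_mul]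
  rw [← Finset.sum_subset (s₁ := ({uWord, eWord, ebarWord} : Finset CWord)) _ hsub]
  · have h12 : uWord ≠ eWord := by decide
    have h13 : uWord ≠ ebarWord := by decide
    have h23 : eWord ≠ ebarWord := by decide
    rw [Finset.sum_insert (by simp [h12, h13]), Finset.sum_insert (by simp [h23]), Finset.sum_singleton]
    have e1 : (∏ f, c f (uWord f)) = ∏ f, c f 1 := Finset.prod_congr rfl fun f _ => by fin_cases f <;> rfl
    have e2 : (∏ f, c f (eWord f)) = ∏ f, c f 3 := Finset.prod_congr rfl fun f _ => by fin_cases f <;> rfl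
    have e3 : (∏ f, c f (ebarWord f)) = ∏ f, c f 4 := Finset.prod_congr rfl fun f _ => by fin_cases f <;> rfl
    rw [e1, e2, e3]; ring
  · intro w hw
    rw [Finset.mem_filter]
    refine ⟨Finset.mem_univ _, ?_⟩
    simp only [Finset.mem_insert, Finset.mem_singleton] at hw
    rcases hw with h | h | h
    · left; rw [h]; exact uWord_eFree.1
    · right; left; exact h
    · right; right; exact h

/-- **`Σν ∏ G = 16 N(uuuu) − 4μ − 4μ̄`.** -/
theorem halfSum_GGGG (C : MConfig) (mN mP : MCell → ℤ) (hA1 : ClassScreen (C.wch mN mP)) :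
    HS C mN mP (fun _ => cG) = 16 * C.wch mN mP uWord + (-4) * C.wch mN mP eWord + (-4) * C.wch mN mP ebarWord := by
  rw [HS_ueE C mN mP _ (fun _ j hj => cG_support j hj) hA1]
  have h1 : (∏ _f : Fin 4, cG 1) = 16 := by rw [Finset.prod_const, Finset.card_univ, Fintype.card_fin]; decide
  have h3 : (∏ _f : Fin 4, cG 3) = -4 := by rw [Finset.prod_const, Finset.card_univ, Fintype.card_fin]; decide
  have h4 : (∏ _f : Fin 4, cG 4) = -4 := by rw [Finset.prod_const, Finset.card_univ, Fintype.card_fin]; decide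
  rw [h1, h3, h4]

/-- the mixed coefficient vector `(G, G, G, G')`. -/
def cMix : Fin 4 → Fin 6 → GaussianInt := ![cG, cG, cG, cG']

/-- **`Σν GGGG' = 16 N(uuuu) − 4iμ + 4iμ̄`.** -/
theorem halfSum_GGGG' (C : MConfig) (mN mP : MCell → ℤ) (hA1 : ClassScreen (C.wch mN mP)) :
    HS C mN mP cMix = 16 * C.wch mN mP uWord + ⟨0, -4⟩ * C.wch mN mP eWord + ⟨0, 4⟩ * C.wch mN mP ebarWord := by
  have hc : ∀ f j, cMix f j ≠ 0 → j = 1 ∨ j = 3 ∨ j = 4 := fun f j hj => by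
    fin_cases f
    · exact cG_support j hj
    · exact cG_support j hj
    · exact cG_support j hj
    · exact cG'_support j hj
  rw [HS_ueE C mN mP _ hc hA1]
  have h1 : (∏ f : Fin 4, cMix f 1) = 16 := by rw [Fin.prod_univ_four]; decide
  have h3 : (∏ f : Fin 4, cMix f 3) = ⟨0, -4⟩ := by rw [Fin.prod_univ_four]; decide
  have h4 : (∏ f : Fin 4, cMix f 4) = ⟨0, 4⟩ := by rw [Fin.prod_univ_four]; decide
  rw [h1, h3, h4]

/-- the coefficient vector `(G, G, p, 1)`. -/
def cUUP : Fin 4 → Fin 6 → GaussianInt := ![cG, cG, cP, c1]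

/-- **`Σν G G p 1 = 4 N(uup1)`.** -/
theorem halfSum_GGp1 (C : MConfig) (mN mP : MCell → ℤ) (hA1 : ClassScreen (C.wch mN mP)) :
    HS C mN mP cUUP = 4 * C.wch mN mP uupWord := by
  rw [HS_expand_screen C mN mP _ hA1]
  have hsub : ∀ w ∈ Finset.univ.filter (fun w : CWord => EFree w ∨ w = eWord ∨ w = ebarWord),
      w ∉ ({uupWord} : Finset CWord) → (∏ f, cUUP f (w f)) * C.wch mN mP w = 0 := by
    intro w hw hn
    rw [Finset.mem_filter] at hw
    rw [Finset.mem_singleton] at hn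
    have : ∃ f, cUUP f (w f) = 0 := by
      by_contra hne
      push Not at hne
      have h2 : w 2 = 5 := by
        have := hne 2; revert this; generalize w 2 = j; fin_cases j <;> simp [cUUP, cP]
      have h3 : w 3 = 0 := by
        have := hne 3; revert this; generalize w 3 = j; fin_cases j <;> simp [cUUP, c1]
      have h0 : w 0 = 1 ∨ w 0 = 3 ∨ w 0 = 4 := cG_support _ (hne 0)
      have h1 : w 1 = 1 ∨ w 1 = 3 ∨ w 1 = 4 := cG_support _ (hne 1)
      -- `w` is e-mixed unless `w 0 = w 1 = u`; it is neither `eeee` nor `ēēēē` (letter `p` at slot 2)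
      have hne1 : w ≠ eWord := fun h => by rw [h] at h2; exact absurd h2 (by decide)
      have hne2 : w ≠ ebarWord := fun h => by rw [h] at h2; exact absurd h2 (by decide)
      rcases hw.2 with he | he | he
      · have e0 : w 0 = 1 := by rcases h0 with h | h | h; exact h; exact absurd h (he 0).1; exact absurd h (he 0).2
        have e1 : w 1 = 1 := by rcases h1 with h | h | h; exact h; exact absurd h (he 1).1; exact absurd h (he 1).2
        exact hn (funext fun f => by fin_cases f <;> simp [uupWord, e0, e1, h2, h3])
      · exact hne1 he
      · exact hne2 he
    rw [prod_coef_eq_zero this, zero_mul]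
  rw [← Finset.sum_subset (s₁ := ({uupWord} : Finset CWord)) _ hsub, Finset.sum_singleton]
  · have e1 : (∏ f, cUUP f (uupWord f)) = 4 := by rw [Fin.prod_univ_four]; decide
    rw [e1]
  · intro w hw
    rw [Finset.mem_singleton] at hw
    rw [Finset.mem_filter]
    exact ⟨Finset.mem_univ _, Or.inl (hw ▸ uupWord_eFree.1)⟩

/-! ## §4 the integers: parity-axial letters make `G, G', p` divisible by `4` -/

/-- a PARITY-AXIAL letter: `β` on an axis (or zero) and `α ≡ |β| (mod 2)` — every letter of every `◇_h`. -/
def ParityAxial (x : BPoint) : Prop := (x.2.1 = 0 ∨ x.2.2 = 0) ∧ (2 : ℤ) ∣ x.1 + x.2.1 + x.2.2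

/-- parity-axial ⇒ `4 ∣ G(x)`. -/
theorem four_dvd_G {x : BPoint} (hx : ParityAxial x) : (4 : ℤ) ∣ 2 * (x.1 + x.2.1 + x.2.2) := by
  obtain ⟨k, hk⟩ := hx.2; exact ⟨k, by rw [hk]; ring⟩

/-- parity-axial ⇒ `4 ∣ G'(x)`. -/
theorem four_dvd_G' {x : BPoint} (hx : ParityAxial x) : (4 : ℤ) ∣ 2 * (x.1 + x.2.1 - x.2.2) := by
  obtain ⟨k, hk⟩ := hx.2
  rcases hx.1 with h0 | h0
  · exact ⟨k - x.2.2, by rw [h0] at hk ⊢; linarith⟩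
  · exact ⟨k, by rw [h0] at hk ⊢; linarith⟩

/-- parity-axial ⇒ `4 ∣ p(x) = α² − |β|²`. -/
theorem four_dvd_p {x : BPoint} (hx : ParityAxial x) : (4 : ℤ) ∣ x.1 ^ 2 - x.2.1 ^ 2 - x.2.2 ^ 2 := by
  obtain ⟨k, hk⟩ := hx.2
  rcases hx.1 with h0 | h0
  · rw [h0] at hk ⊢
    have : x.1 = 2 * k - x.2.2 := by linarith
    exact ⟨k ^ 2 - k * x.2.2, by rw [this]; ring⟩
  · rw [h0] at hk ⊢
    have : x.1 = 2 * k - x.2.1 := by linarith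
    exact ⟨k ^ 2 - k * x.2.1, by rw [this]; ring⟩

/-- the integer behind `HS(c)` when every letter functional is integer-valued. -/
def HSint (C : MConfig) (mN mP : MCell → ℤ) (g : Fin 4 → BPoint → ℤ) : ℤ :=
  ∑ Z ∈ C.lower, mN Z * ∏ f, g f (Z f) - ∑ P ∈ C.upper, mP P * ∏ f, g f (P f)

/-- a pairing whose letter functionals take integer values `g` is the integer pairing `HSint g`. -/
theorem HS_eq_HSint (C : MConfig) (mN mP : MCell → ℤ) (c : Fin 4 → Fin 6 → GaussianInt) (g : Fin 4 → BPoint → ℤ)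
    (hcg : ∀ f x, lfun (c f) x = ((g f x : ℤ) : GaussianInt)) :
    HS C mN mP c = ((HSint C mN mP g : ℤ) : GaussianInt) := by
  unfold HS HSint
  push_cast
  simp_rw [hcg]

/-- a product of four integers each divisible by `4` is divisible by `256`. -/
theorem dvd256_prod4 (a : Fin 4 → ℤ) (h : ∀ f, (4 : ℤ) ∣ a f) : (256 : ℤ) ∣ ∏ f, a f := by
  rw [Fin.prod_univ_four, show (256 : ℤ) = 4 * 4 * 4 * 4 by norm_num]
  exact mul_dvd_mul (mul_dvd_mul (mul_dvd_mul (h 0) (h 1)) (h 2)) (h 3)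

/-- if `d` divides every product of the four integer letter values, then `d ∣ HSint`. -/
theorem dvd_HSint (C : MConfig) (mN mP : MCell → ℤ) (g : Fin 4 → BPoint → ℤ) (d : ℤ)
    (hd : ∀ Z ∈ C.lower ∪ C.upper, d ∣ ∏ f, g f (Z f)) : d ∣ HSint C mN mP g := by
  unfold HSint
  apply dvd_sub
  · exact Finset.dvd_sum fun Z hZ => (hd Z (Finset.mem_union_left _ hZ)).mul_left _
  · exact Finset.dvd_sum fun P hP => (hd P (Finset.mem_union_right _ hP)).mul_left _

/-! ## §5 THE LAW -/

/-- the functionals as integer letter maps. -/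
def gG : BPoint → ℤ := fun x => 2 * (x.1 + x.2.1 + x.2.2)
/-- the integer values of `G'`. -/
def gG' : BPoint → ℤ := fun x => 2 * (x.1 + x.2.1 - x.2.2)
/-- the integer values of `p`. -/
def gP : BPoint → ℤ := fun x => x.1 ^ 2 - x.2.1 ^ 2 - x.2.2 ^ 2
/-- the integer values of `1`. -/
def g1 : BPoint → ℤ := fun _ => 1

/-- `N(uuuu)` is a (rational) integer: its imaginary part vanishes. -/
theorem wch_uWord_im (C : MConfig) (mN mP : MCell → ℤ) : (C.wch mN mP uWord).im = 0 := by
  rw [wch_apply]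
  have hc : ∀ Z : MCell, Z.ch uWord = ((∏ f, (Z f).1 : ℤ) : GaussianInt) := fun Z => by
    rw [LinePhaseTorus.ch_eq_prod]; push_cast
    refine Finset.prod_congr rfl fun f _ => ?_
    fin_cases f <;> simp [uWord, bphi, phiVec]
  simp_rw [hc]
  have : (∑ Z ∈ C.lower, (mN Z : GaussianInt) * ((∏ f, (Z f).1 : ℤ) : GaussianInt) -
      ∑ P ∈ C.upper, (mP P : GaussianInt) * ((∏ f, (P f).1 : ℤ) : GaussianInt)) =
      ((∑ Z ∈ C.lower, mN Z * ∏ f, (Z f).1 - ∑ P ∈ C.upper, mP P * ∏ f, (P f).1 : ℤ) : GaussianInt) := by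
    push_cast; rfl
  rw [this, Zsqrtd.im_intCast]

/-- **HALF-SUM LATTICE LAW.**  For every integer (A1)-clean design all of whose letters are parity-axial:
`16 ∣ N(uuuu)`, `32 ∣ re μ`, `32 ∣ im μ` — with the exact identities `8 re μ = 16 N(uuuu) − Σν∏G`,
`8 im μ = Σν GGGG' − 16 N(uuuu)`. -/
theorem parityAxialDesign_mu_dvd (C : MConfig) (mN mP : MCell → ℤ)
    (hpa : ∀ Z ∈ C.lower ∪ C.upper, ∀ f, ParityAxial (Z f)) (hA1 : ClassScreen (C.wch mN mP)) :
    (16 : ℤ) ∣ (C.wch mN mP uWord).re ∧ (32 : ℤ) ∣ (C.wch mN mP eWord).re ∧ (32 : ℤ) ∣ (C.wch mN mP eWord).im := by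
  have hstar : C.wch mN mP ebarWord = star (C.wch mN mP eWord) := C.wch_ebarWord_eq_star mN mP
  have hqim : (C.wch mN mP uWord).im = 0 := wch_uWord_im C mN mP
  -- (C): 4 N(uup1) = Σν G G p 1, an integer divisible by 4·4·4 ⇒ 16 ∣ N(uuuu)
  have eC := halfSum_GGp1 C mN mP hA1
  rw [wch_uup_eq C mN mP hA1, HS_eq_HSint C mN mP cUUP ![gG, gG, gP, g1] (fun f x => by
      fin_cases f
      · exact lfun_cG x
      · exact lfun_cG x
      · exact lfun_cP x
      · exact lfun_c1 x)] at eC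
  have dC : (64 : ℤ) ∣ HSint C mN mP ![gG, gG, gP, g1] := dvd_HSint _ _ _ _ _ fun Z hZ => by
    rw [Fin.prod_univ_four, show (64 : ℤ) = 4 * 4 * 4 * 1 by norm_num]
    exact mul_dvd_mul (mul_dvd_mul (mul_dvd_mul (four_dvd_G (hpa Z hZ 0)) (four_dvd_G (hpa Z hZ 1)))
      (four_dvd_p (hpa Z hZ 2))) (one_dvd _)
  have eCre := congrArg Zsqrtd.re eC
  norm_num at eCre
  have d16 : (16 : ℤ) ∣ (C.wch mN mP uWord).re := by
    obtain ⟨k, hk⟩ := dC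
    rw [hk] at eCre
    exact ⟨k, by linarith⟩
  -- (A): Σν∏G = 16 q − 4μ − 4μ̄; real parts: HSint = 16 q.re − 8 μ.re
  have eA := halfSum_GGGG C mN mP hA1
  rw [HS_eq_HSint C mN mP (fun _ => cG) (fun _ => gG) (fun _ x => lfun_cG x), hstar] at eA
  have dA : (256 : ℤ) ∣ HSint C mN mP (fun _ => gG) := dvd_HSint _ _ _ _ _ fun Z hZ =>
    dvd256_prod4 _ fun f => four_dvd_G (hpa Z hZ f)
  have eAre := congrArg Zsqrtd.re eA
  norm_num [hqim] at eAre
  -- (B): Σν GGGG' = 16 q − 4iμ + 4iμ̄; real parts: HSint = 16 q.re + 8 μ.im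
  have eB := halfSum_GGGG' C mN mP hA1
  rw [HS_eq_HSint C mN mP cMix ![gG, gG, gG, gG'] (fun f x => by
      fin_cases f
      · exact lfun_cG x
      · exact lfun_cG x
      · exact lfun_cG x
      · exact lfun_cG' x), hstar] at eB
  have dB : (256 : ℤ) ∣ HSint C mN mP ![gG, gG, gG, gG'] := dvd_HSint _ _ _ _ _ fun Z hZ => by
    rw [Fin.prod_univ_four, show (256 : ℤ) = 4 * 4 * 4 * 4 by norm_num]
    exact mul_dvd_mul (mul_dvd_mul (mul_dvd_mul (four_dvd_G (hpa Z hZ 0)) (four_dvd_G (hpa Z hZ 1)))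
      (four_dvd_G (hpa Z hZ 2))) (four_dvd_G' (hpa Z hZ 3))
  have eBre := congrArg Zsqrtd.re eB
  norm_num [hqim] at eBre
  refine ⟨d16, ?_, ?_⟩
  · obtain ⟨k, hk⟩ := dA
    obtain ⟨j, hj⟩ := d16
    rw [hk] at eAre
    exact ⟨j - k, by linarith⟩
  · obtain ⟨k, hk⟩ := dB
    obtain ⟨j, hj⟩ := d16
    rw [hk] at eBre
    exact ⟨k - j, by linarith⟩

end Summit.Ventures.HSemireg.HalfSum
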